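import Mathlib
import Summits.CriticalPhenomena.CardyFormulaZ2.Theorems.CardySelfRefinementDefs
import Summits.CriticalPhenomena.CardyFormulaZ2.Theorems.CardySelfRefinementTrivialSectorRateStubSixArmSectorMassFactorisation
import Summits.CriticalPhenomena.CardyFormulaZ2.Theorems.CardySelfRefinementTrivialSectorRateStubSixArmSectorMassSummation
import HarnessLib

/-!
# The corrected stub `stub_sixArmSectorMass` (line `far-field-is-a-quarter-turn`, crux
`TrivialSectorRate`, stmt-CriticalPhenomena-10266)

The registered stub `stub_sixArmSectorMass` asserts `SixArmDecayAlong k γ ⟹` "the six-arm sector terms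
of the far blocks total `O(η^ε)`" for EVERY finite family of topological quads, with no hypothesis on
the relevance of boxes near the quad boundaries.  Its planner proof (skeleton docstring, STUB 6) uses
a boundary relevance decay `P(Rel) ≤ C (2^j η)^β`, `β > 1`, that no hypothesis supplies (and, for
fractal quad boundaries, no block count either).  The corrected statement adds, per `(k, γ, F)`, the
boundary-relevance hypothesis (HB) — VERBATIM the one added to the corrected `stub_pivotalMass`
(`weightedPivotalMass_of_factorisation`), so that ONE upstream hypothesis serves both mass stubs — and
is PROVED here: `sixArmSectorMass_corrected` = `sixArmSectorMass_of_boundaryRelevance` (dyadic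
summation) + `Six_le_real_sixArm_mul_real_Rel` (far-field factorisation, proved from the product
structure of `M_k`).
-/

noncomputable section

namespace Summit.CriticalPhenomena.CardyFormulaZ2.Theorems.CardySelfRefinement.FarField

open scoped Topology
open Filter Set MeasureTheory
open Literature.Probability.LatticeModels Literature.Probability.Percolation
open Literature.Probability.Percolation.QuadCrossing
open Summit.CriticalPhenomena.CardyFormulaZ2.Theses.CardySelfRefinement

/-- **CORRECTED `stub_sixArmSectorMass`** (registered helper): along a path with six-arm decay, for
every quad family satisfying BOUNDARY RELEVANCE ABOVE ONE along the path (hypothesis (HB), verbatim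
that of the corrected `stub_pivotalMass`) and every `R₀ ≥ 1`, the six-arm sector terms of the far
blocks, each at its own far-field scale, total `O(η^ε)` uniformly in `s`, small `η` and finite `U`. -/
theorem sixArmSectorMass_corrected :
    ∀ k : ℕ, k = 2 ∨ k = 3 → ∀ γ : unitInterval → ℝ × ℝ, PathOK k γ → SixArmDecayAlong k γ →
      ∀ (m : ℕ) (F : Fin m → Quad (univ : Set ℂ)),
        (∃ b C₀ η₀ : ℝ, 0 < b ∧ 0 < η₀ ∧ ∀ (s : unitInterval), ∀ η ∈ Set.Ioo (0 : ℝ) η₀, ∀ (D : ℕ), 1 ≤ D →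
          ∀ U : Finset (Site 2),
            ∑ u ∈ U.filter (fun u => bdist k m F η u < 2 * D * η),
              (M k (γ s).1 (γ s).2).real (Rel k m F η u D) ≤ C₀ * (D : ℝ) ^ 2 * min 1 (((D : ℝ) * η) ^ b)) →
        ∀ (R₀ : ℕ), 1 ≤ R₀ →
          ∃ ε C η₁ : ℝ, 0 < ε ∧ 0 ≤ C ∧ 0 < η₁ ∧ ∀ (s : unitInterval), ∀ η ∈ Set.Ioo (0 : ℝ) η₁,
            ∀ U : Finset (Site 2),
              ∑ u ∈ U.filter (fun u => (R₀ : ℝ) ≤ farScale k m F η u),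
                Six k m F η (γ s) u ⌊farScale k m F η u⌋₊ ≤ C * η ^ ε := by
  intro k hk γ _hγ h6 m F hB R₀ hR₀
  have hk0 : 0 < k := by rcases hk with rfl | rfl <;> norm_num
  refine sixArmSectorMass_of_boundaryRelevance hk0 h6 hB ?_ R₀ hR₀
  intro s η hη u R' R hR' hR
  exact Six_le_real_sixArm_mul_real_Rel hk0 m F hη.ne' (γ s) u hR' hR

end Summit.CriticalPhenomena.CardyFormulaZ2.Theorems.CardySelfRefinement.FarField

end
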